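import Mathlib.Tactic.Linarith
import Summits.CriticalPhenomena.PercolationContinuityZ3.Theorems.PercNearOneGluingNoHeavyLowerTailSahiCTCHarrisBlock
import HarnessLib

/-!
# `NoHeavyLowerTail` (crux stmt-CriticalPhenomena-4575), P3 lane: the Harris block for UP-SETS, profile-wise —
# `Π·GF(𝒳 ∩ 𝒵) − GF(𝒳)·GF(𝒵) ∈ ℕ[s]` for up-sets `𝒳, 𝒵`, by member-complementation from the down-set block

Support file (seat `prim-l12-p3`, gen 24; `--supports stmt-CriticalPhenomena-4575`).  Memo
`run/shared/lean/prim/prim-l12/FROM-prim-l12-p3-g24-VALUE-LEVEL-TH2K.md` §3.  Companion of `…SahiCTCHarrisBlock` (`coeff_harris`: the same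
statement for DOWN-sets).  The complement-dual language of the threshold slots (memo g23 §3, g24 §1) works with up-sets of OPEN sets, and the
co-level-1 theorem of memo g24 §3 (CTC_{k−1}(k) for every `k`) needs the Harris block there.  THIS FILE transports `coeff_harris` through the
member-complement map `S ↦ V ∖ S` (`coFam`), which sends up-sets to down-sets and reverses profiles (`n ↦ 2·𝟙 − n` on the profiles `n ≤ 2` that
carry products of two generating functions):
* `coeff_gf_mul_gf_coFam` : `coeff_{2𝟙−n}(GF(F̄)·GF(Ḡ)) = coeff_n(GF(F)·GF(G))` for `n ≤ 2` pointwise;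
* **`coeff_harris_up`**, `coeff_harris_up_sub_nonneg` : for up-sets `𝒳, 𝒵`: `coeff_n(GF(𝒳)·GF(𝒵)) ≤ coeff_n(Π·GF(𝒳 ∩ 𝒵))` for every profile.
Nothing is asserted about the crux.
-/

namespace Summit.CriticalPhenomena.PercolationContinuityZ3.Theorems.SahiCTCForms

open Finset MvPolynomial SahiCTCGenFun

variable {α : Type*} [DecidableEq α] [Fintype α]

/-! ### Member-complementation -/

/-- The member-complement family `F̄ = {V ∖ S : S ∈ F}`. [this work] -/
def coFam (F : Finset (Finset α)) : Finset (Finset α) := F.image fun S => univ \ S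

omit [DecidableEq α] in
/-- `V ∖ (V ∖ S) = S`. [this work] -/
theorem univ_sdiff_univ_sdiff [DecidableEq α] (S : Finset α) : (univ : Finset α) \ (univ \ S) = S :=
  Finset.sdiff_sdiff_eq_self (subset_univ S)

/-- Membership in the member-complement family. [this work] -/
theorem mem_coFam {F : Finset (Finset α)} {S : Finset α} : S ∈ coFam F ↔ univ \ S ∈ F := by
  unfold coFam
  constructor
  · intro h
    obtain ⟨T, hT, rfl⟩ := mem_image.1 h
    rwa [univ_sdiff_univ_sdiff]
  · intro h
    exact mem_image.2 ⟨univ \ S, h, univ_sdiff_univ_sdiff S⟩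

/-- The member-complement of an up-set is a down-set. [this work] -/
theorem isLowerSet_coFam {F : Finset (Finset α)} (hF : IsUpperSet (F : Set (Finset α))) :
    IsLowerSet ((coFam F : Finset (Finset α)) : Set (Finset α)) := by
  intro S T hTS hS
  rw [Finset.mem_coe, mem_coFam] at hS ⊢
  exact hF (sdiff_subset_sdiff Subset.rfl hTS) hS

/-- Member-complementation commutes with intersection. [this work] -/
theorem coFam_inter (F G : Finset (Finset α)) : coFam (F ∩ G) = coFam F ∩ coFam G := by
  ext S; simp only [mem_coFam, mem_inter]

/-- The member-complement of the whole power set is the whole power set. [this work] -/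
theorem coFam_univ_powerset : coFam (univ.powerset : Finset (Finset α)) = univ.powerset := by
  ext S; simp only [mem_coFam, mem_powerset, subset_univ]

/-! ### Profile reversal -/

/-- The reversed profile `2·𝟙 − n` (truncated subtraction; used only for `n ≤ 2` pointwise). [this work] -/
noncomputable def rev2 (n : α →₀ ℕ) : α →₀ ℕ := 2 • ind (univ : Finset α) - n

/-- `(2·𝟙 − n) i = 2 − n i`. [this work] -/
theorem rev2_apply (n : α →₀ ℕ) (i : α) : rev2 n i = 2 - n i := by
  unfold rev2
  rw [Finsupp.tsub_apply, Finsupp.smul_apply, ind_apply, if_pos (mem_univ i)]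
  simp

/-- Complementing both members reverses the profile: `1_{V∖P} + 1_{V∖S} = 2·𝟙 − n ↔ 1_P + 1_S = n` (for `n ≤ 2` pointwise). [this work] -/
theorem ind_compl_add_ind_compl_eq_iff {n : α →₀ ℕ} (hn : ∀ i, n i ≤ 2) (P S : Finset α) :
    ind (univ \ P) + ind (univ \ S) = rev2 n ↔ ind P + ind S = n := by
  constructor
  · intro h
    ext i
    have hi := DFunLike.congr_fun h i
    rw [Finsupp.add_apply, ind_apply, ind_apply, rev2_apply] at hi
    rw [Finsupp.add_apply, ind_apply, ind_apply]
    simp only [mem_sdiff, mem_univ, true_and] at hi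
    have := hn i
    split_ifs at hi ⊢ <;> omega
  · intro h
    ext i
    have hi := DFunLike.congr_fun h i
    rw [Finsupp.add_apply, ind_apply, ind_apply] at hi
    rw [Finsupp.add_apply, ind_apply, ind_apply, rev2_apply]
    simp only [mem_sdiff, mem_univ, true_and]
    have := hn i
    split_ifs at hi ⊢ <;> omega

/-- **Reversal of a two-factor coefficient**: `coeff_{2𝟙−n}(GF(F̄)·GF(Ḡ)) = coeff_n(GF(F)·GF(G))` for `n ≤ 2` pointwise. [this work] -/
theorem coeff_gf_mul_gf_coFam (F G : Finset (Finset α)) {n : α →₀ ℕ} (hn : ∀ i, n i ≤ 2) :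
    (gf (coFam F) * gf (coFam G)).coeff (rev2 n) = (gf F * gf G).coeff n := by
  rw [coeff_gf_mul_gf, coeff_gf_mul_gf]
  symm
  refine congrArg _ (card_bij' (fun PS _ => (univ \ PS.1, univ \ PS.2)) (fun PS _ => (univ \ PS.1, univ \ PS.2))
    (fun PS hPS => ?_) (fun PS hPS => ?_) (fun PS _ => ?_) (fun PS _ => ?_))
  · obtain ⟨hmem, hsum⟩ := mem_filter.1 hPS
    obtain ⟨h1, h2⟩ := mem_product.1 hmem
    refine mem_filter.2 ⟨mem_product.2 ⟨?_, ?_⟩, (ind_compl_add_ind_compl_eq_iff hn _ _).2 hsum⟩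
    · exact mem_coFam.2 (by rw [univ_sdiff_univ_sdiff]; exact h1)
    · exact mem_coFam.2 (by rw [univ_sdiff_univ_sdiff]; exact h2)
  · obtain ⟨hmem, hsum⟩ := mem_filter.1 hPS
    obtain ⟨h1, h2⟩ := mem_product.1 hmem
    refine mem_filter.2 ⟨mem_product.2 ⟨mem_coFam.1 h1, mem_coFam.1 h2⟩, ?_⟩
    rw [← ind_compl_add_ind_compl_eq_iff hn, univ_sdiff_univ_sdiff, univ_sdiff_univ_sdiff]
    exact hsum
  · simp only [univ_sdiff_univ_sdiff]
  · simp only [univ_sdiff_univ_sdiff]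

/-! ### The Harris block for up-sets -/

/-- **The Harris block for UP-SETS, profile-wise**: for up-sets `𝒳, 𝒵` every coefficient of `GF(𝒳)·GF(𝒵)` is at most the corresponding
coefficient of `Π·GF(𝒳 ∩ 𝒵)`. [this work] -/
theorem coeff_harris_up {F G : Finset (Finset α)} (hF : IsUpperSet (F : Set (Finset α))) (hG : IsUpperSet (G : Set (Finset α)))
    (n : α →₀ ℕ) : (gf F * gf G).coeff n ≤ (PiP * gf (F ∩ G)).coeff n := by
  by_cases hn : ∀ i, n i ≤ 2
  swap
  · rw [coeff_gf_mul_gf, filter_prod_eq_empty _ _ n hn, card_empty]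
    unfold PiP
    rw [coeff_gf_mul_gf]
    exact_mod_cast Nat.zero_le _
  have h := coeff_harris (isLowerSet_coFam hF) (isLowerSet_coFam hG) (rev2 n)
  rw [coeff_gf_mul_gf_coFam F G hn, ← coFam_inter] at h
  unfold PiP at h ⊢
  rw [← coFam_univ_powerset, coeff_gf_mul_gf_coFam _ _ hn] at h
  exact h

/-- `Π·GF(𝒳 ∩ 𝒵) − GF(𝒳)·GF(𝒵) ∈ ℕ[s]` for up-sets `𝒳, 𝒵`. [this work] -/
theorem coeff_harris_up_sub_nonneg {F G : Finset (Finset α)} (hF : IsUpperSet (F : Set (Finset α)))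
    (hG : IsUpperSet (G : Set (Finset α))) (n : α →₀ ℕ) : 0 ≤ (PiP * gf (F ∩ G) - gf F * gf G).coeff n := by
  rw [coeff_sub, sub_nonneg]; exact coeff_harris_up hF hG n

end Summit.CriticalPhenomena.PercolationContinuityZ3.Theorems.SahiCTCForms
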